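/-
Copyright (c) 2026 the pub-hodgecm-mathlib formalisation cell (harness21).  Prover seat hodgecm-mathlib-F0P3a-p04 (g19): road «S3-ram» ((Cnt2′) chair F0P3a-p07 (g14),
RULING (11): route B, EVEN-ROOT twin of `strataCount_J₀_block`, organ (E1); owner F0P3a-p06 (g15)); 2026-09-02.
-/
import Literature.NumberTheory.Rogawski1990.DepthZeroKappaTransferTypeOneRamifiedRootRegionInduction   -- ★ ENGINE ED. 3 (F0P3a-p02): root-region assembly, label-agnostic §3
import HarnessLib

/-!
# The ramified `κ`-orbital integral: the ROOT-REGION ASSEMBLY with EVEN root depth — off-region grandchildren labelled `E_k ∕ O_k ∕ P⁺_k ∕ P⁻_k`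
# (Kottwitz 1986 §3; Rogawski 1990 §4.9; Serre, *Trees* I.2.3)

Topic `NumberTheory/Rogawski1990`; namespace `Literature.NumberTheory.Rogawski1990`.  THEOREMS ONLY (no definition, no instance, no notation, no named fact, no `sorry`);
kernel lane `--supports stmt-HodgeConjecture-24833`; a GENERIC rooted-tree statement (any `SimpleGraph`), sequel of ★ ENGINE ED. 3 `DepthZeroKappaTransferTypeOneRamifiedRootRegionInduction`
(F0P3a-p02): its §3 `strataVec_total_eq_of_localLaw_of_rootRegion` is LABEL-AGNOSTIC, its §4 `…_of_labels` fixes the ODD-root-depth label pattern of the off-region grandchildren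
(`E_{k+1} ∕ P^±_k`, root depth `2k+3`).  Cell `pub/hodgecm-mathlib` (D-0151), crux H413; road «S3-ram» (count-neutral); (Cnt2′) route B (chair F0P3a-p07 (g14) RULINGS (9a′)(11)):
for the TYPE-(2) block literal the root depth `D` of the `J₀`-model takes BOTH parities, and with `D = 2k+2` EVEN the off-region grandchildren `w` of a region vertex have
`dep w ∈ {2k, 2k+1}` (sandwich) with the rank at the ODD depth `2k+1` not forced — three shell types `E_k = (2k, 2)` (a `B`-leaf if `k = 0`), `O_k = (2k+1, 2)`, `P^±_k = (2k+1, 1, ±)`.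

* **`strataVec_total_eq_of_localLaw_of_rootRegion_of_labels_even`** — ★ §3 with the off-region grandchildren of each `v ∈ R` labelled `E_{k_v} ∕ O_{k_v} ∕ P⁺_{k_v} ∕ P⁻_{k_v}` with
  multiplicities `NE v, NO v, NP v, NM v`: TOTAL `= Σ_{v ∈ R} (e₄ + NE v·(if k_v = 0 then e_bd else T(E_{k_v})) + NO v·T(O_{k_v}) + NP v·T(P⁺_{k_v}) + NM v·T(P⁻_{k_v}))`.
  Proof = ★ §4's, with a three-way split of the off-region Finset (depth `2k_v` ∕ depth `2k_v+1` rank `2` ∕ rank `1` by class).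

HONEST LABEL: HC_CM is proved only modulo the 2 remaining named inputs (hLiu418 24832, h413 24833) until rung 0 closes; nothing printed is asserted here (rooted-tree bookkeeping).

## References
* [Kottwitz1986] R. E. Kottwitz, *Base change for unit elements of Hecke algebras*, Compositio Math. 60 (1986), §3 (counting fixed lattices shell by shell).
* [Rogawski1990] J. D. Rogawski, *Automorphic Representations of Unitary Groups in Three Variables*, Ann. of Math. Stud. 123 (1990), §4.9 pp. 54–56.
* [Serre1980Trees] J.-P. Serre, *Trees* (1980), I.2.3 (cones, projection onto a subtree), II.1.1 (the tree of lattices).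
-/

set_option autoImplicit false

open Finset SimpleGraph
open Literature.Combinatorics.SimpleGraph.TreeLayers

namespace Literature.NumberTheory.Rogawski1990

variable {V : Type*} {G : SimpleGraph V}

/-- **THE ROOT-REGION ASSEMBLY WITH EVEN ROOT DEPTH** (off-region grandchildren of each region vertex `v` labelled `E_{k_v}` (`B`-leaf if `k_v = 0`) ∕ `O_{k_v}` ∕ `P^±_{k_v}`
with multiplicities `NE v ∕ NO v ∕ NP v ∕ NM v`): the TOTAL strata vector of the fixed self-dual vertices is
`Σ_{v ∈ R} (e₄ + NE v·(if k_v = 0 then e_bd else T(E_{k_v})) + NO v·T(O_{k_v}) + NP v·T(P⁺_{k_v}) + NM v·T(P⁻_{k_v}))`. [cite: Kottwitz1986, §3] [cite: Rogawski1990, §4.9 pp. 54–56] [cite: Serre1980Trees, I.2.3] -/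
theorem strataVec_total_eq_of_localLaw_of_rootRegion_of_labels_even (hT : G.IsTree) (r : V) (F : Set V) (hFfin : F.Finite)
    (hF : ∀ w ∈ F, w ≠ r → ∀ u, G.Adj w u → G.dist r u + 1 = G.dist r w → u ∈ F) (SD : V → Prop) (str : Fin 5 → V → Prop)
    [DecidablePred (· ∈ F)] [DecidablePred SD] [∀ j, DecidablePred (str j)]
    (hSD₁ : ∀ v c, G.Adj v c → SD v → ¬ SD c) (hSD₂ : ∀ c w, G.Adj c w → ¬ SD c → SD w)
    (dep rk : V → ℕ) (cl : V → ℤ)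
    (hstr : ∀ w ∈ F, SD w → (str 0 w ↔ dep w = 0) ∧ (str 1 w ↔ dep w = 1 ∧ rk w = 2) ∧ (str 2 w ↔ dep w = 1 ∧ rk w = 1 ∧ cl w = 1) ∧
      (str 3 w ↔ dep w = 1 ∧ rk w = 1 ∧ cl w = -1) ∧ (str 4 w ↔ 2 ≤ dep w))
    (GC : V → Set V)
    (hGC : ∀ v w, w ∈ GC v ↔ ∃ c, (G.Adj v c ∧ G.dist r c = G.dist r v + 1 ∧ c ∈ F) ∧ (G.Adj c w ∧ G.dist r w = G.dist r c + 1 ∧ w ∈ F))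
    (q : ℕ) (s : ℤ) (R : Set V) (hrR : r ∈ R) (hRF : R ⊆ F) (hRS : ∀ v ∈ R, SD v) (hRdep : ∀ v ∈ R, 2 ≤ dep v)
    (hRup : ∀ v ∈ F, SD v → ∀ w ∈ GC v, w ∈ R → v ∈ R)
    (hrk : ∀ v ∈ F, SD v → v ∉ R → 1 ≤ dep v → rk v = 1 ∨ rk v = 2)
    (hcl : ∀ v ∈ F, SD v → v ∉ R → rk v = 1 → cl v = 1 ∨ cl v = -1)
    (hodd : ∀ v ∈ F, SD v → v ∉ R → 2 ≤ dep v → rk v = 1 → Odd (dep v))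
    (hB : ∀ v ∈ F, SD v → v ∉ R → dep v = 0 → GC v = ∅)
    (hC : ∀ v ∈ F, SD v → v ∉ R → dep v = 1 → rk v = 1 → GC v = ∅)
    (hR : ∀ v ∈ F, SD v → v ∉ R → dep v = 1 → rk v = 2 → (∀ w ∈ GC v, dep w = 0) ∧ (GC v).ncard = q)
    (hE : ∀ v ∈ F, SD v → v ∉ R → ∀ m, dep v = 2 * m + 2 → rk v = 2 → (∀ w ∈ GC v, dep w = 2 * m + 1 ∧ rk w = 2) ∧ (GC v).ncard = q ^ 2)
    (hO : ∀ v ∈ F, SD v → v ∉ R → ∀ m, dep v = 2 * m + 3 → rk v = 2 →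
      (∀ w ∈ GC v, (dep w = 2 * m + 2 ∧ rk w = 2) ∨ (dep w = 2 * m + 1 ∧ rk w = 1 ∧ (cl w = 1 ∨ cl w = -1))) ∧
        {w | w ∈ GC v ∧ dep w = 2 * m + 2}.ncard = q ∧ {w | w ∈ GC v ∧ dep w = 2 * m + 1 ∧ cl w = 1}.ncard = q.choose 2 ∧
          {w | w ∈ GC v ∧ dep w = 2 * m + 1 ∧ cl w = -1}.ncard = q.choose 2)
    (hP : ∀ v ∈ F, SD v → v ∉ R → ∀ m (c : ℤ), dep v = 2 * m + 3 → rk v = 1 → cl v = c →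
      (∀ w ∈ GC v, dep w = 2 * m + 1 ∧ rk w = 1 ∧ cl w = s * c) ∧ (GC v).ncard = q ^ 2)
    (TE TO : ℕ → Fin 5 → ℕ) (TP : ℤ → ℕ → Fin 5 → ℕ)
    (hTE : ∀ m, TE (m + 1) = ![0, 0, 0, 0, 1] + q ^ 2 • TO m)
    (hTO0 : TO 0 = ![0, 1, 0, 0, 0] + q • ![1, 0, 0, 0, 0])
    (hTOs : ∀ m, TO (m + 1) = ![0, 0, 0, 0, 1] + q • TE (m + 1) + q.choose 2 • (TP 1 m + TP (-1) m))
    (hTP0 : TP 1 0 = ![0, 0, 1, 0, 0]) (hTP0' : TP (-1) 0 = ![0, 0, 0, 1, 0])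
    (hTPs : ∀ m (c : ℤ), c = 1 ∨ c = -1 → TP c (m + 1) = ![0, 0, 0, 0, 1] + q ^ 2 • TP (s * c) m)
    (sR : Finset V) (hsR : ∀ v, v ∈ sR ↔ v ∈ R) (k NE NO NP NM : V → ℕ)
    (hlabR : ∀ v ∈ R, (∀ w ∈ GC v, w ∉ R → (dep w = 2 * k v ∧ (rk w = 2 ∨ dep w = 0)) ∨ (dep w = 2 * k v + 1 ∧ rk w = 2) ∨
        (dep w = 2 * k v + 1 ∧ rk w = 1 ∧ (cl w = 1 ∨ cl w = -1))) ∧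
      {w | w ∈ GC v ∧ w ∉ R ∧ dep w = 2 * k v}.ncard = NE v ∧ {w | w ∈ GC v ∧ w ∉ R ∧ dep w = 2 * k v + 1 ∧ rk w = 2}.ncard = NO v ∧
        {w | w ∈ GC v ∧ w ∉ R ∧ dep w = 2 * k v + 1 ∧ rk w = 1 ∧ cl w = 1}.ncard = NP v ∧
          {w | w ∈ GC v ∧ w ∉ R ∧ dep w = 2 * k v + 1 ∧ rk w = 1 ∧ cl w = -1}.ncard = NM v) :
    (fun j => (F ∩ {w | SD w ∧ str j w}).ncard) =
      ∑ v ∈ sR, ((![0, 0, 0, 0, 1] : Fin 5 → ℕ) + NE v • (if k v = 0 then (![1, 0, 0, 0, 0] : Fin 5 → ℕ) else TE (k v)) + NO v • TO (k v) +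
        NP v • TP 1 (k v) + NM v • TP (-1) (k v)) := by
  classical
  -- the off-region grandchildren Finsets
  have hfin : ∀ v, (GC v ∩ Rᶜ).Finite := fun v => hFfin.subset (fun w hw => by
    obtain ⟨c, -, -, -, hwF⟩ := (hGC v w).1 hw.1
    exact hwF)
  have hsOff : ∀ v ∈ R, ∀ w, w ∈ (hfin v).toFinset ↔ w ∈ GC v ∧ w ∉ R := fun v _ w => by
    rw [Set.Finite.mem_toFinset, Set.mem_inter_iff, Set.mem_compl_iff]
  rw [strataVec_total_eq_of_localLaw_of_rootRegion hT r F hFfin hF SD str hSD₁ hSD₂ dep rk cl hstr GC hGC q s R hrR hRF hRS hRdep hRup hrk hcl hodd hB hC hR hE hO hP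
    TE TO TP hTE hTO0 hTOs hTP0 hTP0' hTPs sR hsR (fun v => (hfin v).toFinset) hsOff]
  refine Finset.sum_congr rfl (fun v hv => ?_)
  have hvR : v ∈ R := (hsR v).1 hv
  obtain ⟨hlab, hcE, hcO, hcP, hcM⟩ := hlabR v hvR
  have hsF : ∀ w, w ∈ (hfin v).toFinset ↔ w ∈ GC v ∧ w ∉ R := hsOff v hvR
  -- split the off-region grandchildren: depth `2k` ∕ depth `2k+1` rank `2` ∕ rank `1` class `+` ∕ rank `1` class `−`
  rw [← Finset.sum_filter_add_sum_filter_not (hfin v).toFinset (fun w => dep w = 2 * k v),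
    ← Finset.sum_filter_add_sum_filter_not ((hfin v).toFinset.filter (fun w => ¬ dep w = 2 * k v)) (fun w => rk w = 2),
    ← Finset.sum_filter_add_sum_filter_not (((hfin v).toFinset.filter (fun w => ¬ dep w = 2 * k v)).filter (fun w => ¬ rk w = 2)) (fun w => cl w = 1)]
  have hrest : ∀ w, w ∈ (hfin v).toFinset → ¬ dep w = 2 * k v →
      dep w = 2 * k v + 1 ∧ (rk w = 2 ∨ (rk w = 1 ∧ (cl w = 1 ∨ cl w = -1))) := by
    intro w hw hne
    obtain ⟨hwG, hwR⟩ := (hsF w).1 hw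
    rcases hlab w hwG hwR with ⟨h, -⟩ | ⟨h, hr⟩ | ⟨h, hr, hc⟩
    · exact absurd h hne
    · exact ⟨h, Or.inl hr⟩
    · exact ⟨h, Or.inr ⟨hr, hc⟩⟩
  have hvE : ∀ w ∈ (hfin v).toFinset.filter (fun w => dep w = 2 * k v),
      (if dep w = 0 then ![1, 0, 0, 0, 0] else if rk w = 2 then (if Even (dep w) then TE (dep w / 2) else TO (dep w / 2)) else TP (cl w) (dep w / 2)
        : Fin 5 → ℕ) = (if k v = 0 then (![1, 0, 0, 0, 0] : Fin 5 → ℕ) else TE (k v)) := by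
    intro w hw
    rw [Finset.mem_filter] at hw
    obtain ⟨hwG, hwR⟩ := (hsF w).1 hw.1
    by_cases hk0 : k v = 0
    · rw [if_pos (by rw [hw.2, hk0]), if_pos hk0]
    · have hrw : rk w = 2 := by
        rcases hlab w hwG hwR with ⟨-, h⟩ | ⟨h, -⟩ | ⟨h, -, -⟩
        · exact h.resolve_right (by omega)
        · omega
        · omega
      rw [if_neg (by omega), if_pos hrw, if_pos (by rw [hw.2]; exact ⟨k v, by ring⟩), hw.2, if_neg hk0, show (2 * k v) / 2 = k v by omega]
  have hvO : ∀ w ∈ ((hfin v).toFinset.filter (fun w => ¬ dep w = 2 * k v)).filter (fun w => rk w = 2),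
      (if dep w = 0 then ![1, 0, 0, 0, 0] else if rk w = 2 then (if Even (dep w) then TE (dep w / 2) else TO (dep w / 2)) else TP (cl w) (dep w / 2)
        : Fin 5 → ℕ) = TO (k v) := by
    intro w hw
    rw [Finset.mem_filter, Finset.mem_filter] at hw
    obtain ⟨hdw, -⟩ := hrest w hw.1.1 hw.1.2
    have hnev : ¬ Even (dep w) := by rw [hdw, Nat.not_even_iff_odd]; exact ⟨k v, rfl⟩
    rw [if_neg (by omega), if_pos hw.2, if_neg hnev, hdw, show (2 * k v + 1) / 2 = k v by omega]
  have hvP : ∀ w ∈ (((hfin v).toFinset.filter (fun w => ¬ dep w = 2 * k v)).filter (fun w => ¬ rk w = 2)).filter (fun w => cl w = 1),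
      (if dep w = 0 then ![1, 0, 0, 0, 0] else if rk w = 2 then (if Even (dep w) then TE (dep w / 2) else TO (dep w / 2)) else TP (cl w) (dep w / 2)
        : Fin 5 → ℕ) = TP 1 (k v) := by
    intro w hw
    rw [Finset.mem_filter, Finset.mem_filter, Finset.mem_filter] at hw
    obtain ⟨hdw, -⟩ := hrest w hw.1.1.1 hw.1.1.2
    rw [if_neg (by omega), if_neg hw.1.2, hw.2, hdw, show (2 * k v + 1) / 2 = k v by omega]
  have hvM : ∀ w ∈ (((hfin v).toFinset.filter (fun w => ¬ dep w = 2 * k v)).filter (fun w => ¬ rk w = 2)).filter (fun w => ¬ cl w = 1),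
      (if dep w = 0 then ![1, 0, 0, 0, 0] else if rk w = 2 then (if Even (dep w) then TE (dep w / 2) else TO (dep w / 2)) else TP (cl w) (dep w / 2)
        : Fin 5 → ℕ) = TP (-1) (k v) := by
    intro w hw
    rw [Finset.mem_filter, Finset.mem_filter, Finset.mem_filter] at hw
    obtain ⟨hdw, hr⟩ := hrest w hw.1.1.1 hw.1.1.2
    have hc : cl w = -1 := by
      rcases hr with h | ⟨-, hc⟩
      · exact absurd h hw.1.2
      · exact hc.resolve_left hw.2
    rw [if_neg (by omega), if_neg hw.1.2, hc, hdw, show (2 * k v + 1) / 2 = k v by omega]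
  have hcE' : ((hfin v).toFinset.filter (fun w => dep w = 2 * k v)).card = NE v := by
    have hset : {w | w ∈ GC v ∧ w ∉ R ∧ dep w = 2 * k v} = ↑((hfin v).toFinset.filter (fun w => dep w = 2 * k v)) := by
      ext w
      simp only [Set.mem_setOf_eq, Finset.coe_filter, Set.Finite.mem_toFinset, Set.mem_inter_iff, Set.mem_compl_iff, and_assoc]
    rw [← hcE, hset, Set.ncard_coe_finset]
  have hcO' : (((hfin v).toFinset.filter (fun w => ¬ dep w = 2 * k v)).filter (fun w => rk w = 2)).card = NO v := by
    have hset : {w | w ∈ GC v ∧ w ∉ R ∧ dep w = 2 * k v + 1 ∧ rk w = 2} =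
        ↑(((hfin v).toFinset.filter (fun w => ¬ dep w = 2 * k v)).filter (fun w => rk w = 2)) := by
      ext w
      simp only [Set.mem_setOf_eq, Finset.coe_filter, Finset.mem_filter, Set.Finite.mem_toFinset, Set.mem_inter_iff, Set.mem_compl_iff]
      constructor
      · rintro ⟨hw, hwR, hd, hr⟩
        exact ⟨⟨⟨hw, hwR⟩, by omega⟩, hr⟩
      · rintro ⟨⟨⟨hw, hwR⟩, hne⟩, hr⟩
        exact ⟨hw, hwR, (hrest w ((hsF w).2 ⟨hw, hwR⟩) hne).1, hr⟩
    rw [← hcO, hset, Set.ncard_coe_finset]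
  have hcP' : ((((hfin v).toFinset.filter (fun w => ¬ dep w = 2 * k v)).filter (fun w => ¬ rk w = 2)).filter (fun w => cl w = 1)).card = NP v := by
    have hset : {w | w ∈ GC v ∧ w ∉ R ∧ dep w = 2 * k v + 1 ∧ rk w = 1 ∧ cl w = 1} =
        ↑((((hfin v).toFinset.filter (fun w => ¬ dep w = 2 * k v)).filter (fun w => ¬ rk w = 2)).filter (fun w => cl w = 1)) := by
      ext w
      simp only [Set.mem_setOf_eq, Finset.coe_filter, Finset.mem_filter, Set.Finite.mem_toFinset, Set.mem_inter_iff, Set.mem_compl_iff]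
      constructor
      · rintro ⟨hw, hwR, hd, hr, hc⟩
        exact ⟨⟨⟨⟨hw, hwR⟩, by omega⟩, by omega⟩, hc⟩
      · rintro ⟨⟨⟨⟨hw, hwR⟩, hne⟩, hnr⟩, hc⟩
        obtain ⟨hd, hr⟩ := hrest w ((hsF w).2 ⟨hw, hwR⟩) hne
        rcases hr with h | ⟨h1, -⟩
        · exact absurd h hnr
        · exact ⟨hw, hwR, hd, h1, hc⟩
    rw [← hcP, hset, Set.ncard_coe_finset]
  have hcM' : ((((hfin v).toFinset.filter (fun w => ¬ dep w = 2 * k v)).filter (fun w => ¬ rk w = 2)).filter (fun w => ¬ cl w = 1)).card = NM v := by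
    have hset : {w | w ∈ GC v ∧ w ∉ R ∧ dep w = 2 * k v + 1 ∧ rk w = 1 ∧ cl w = -1} =
        ↑((((hfin v).toFinset.filter (fun w => ¬ dep w = 2 * k v)).filter (fun w => ¬ rk w = 2)).filter (fun w => ¬ cl w = 1)) := by
      ext w
      simp only [Set.mem_setOf_eq, Finset.coe_filter, Finset.mem_filter, Set.Finite.mem_toFinset, Set.mem_inter_iff, Set.mem_compl_iff]
      constructor
      · rintro ⟨hw, hwR, hd, hr, hc⟩
        exact ⟨⟨⟨⟨hw, hwR⟩, by omega⟩, by omega⟩, by rw [hc]; norm_num⟩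
      · rintro ⟨⟨⟨⟨hw, hwR⟩, hne⟩, hnr⟩, hc⟩
        obtain ⟨hd, hr⟩ := hrest w ((hsF w).2 ⟨hw, hwR⟩) hne
        rcases hr with h | ⟨h1, hcw⟩
        · exact absurd h hnr
        · exact ⟨hw, hwR, hd, h1, hcw.resolve_left hc⟩
    rw [← hcM, hset, Set.ncard_coe_finset]
  rw [Finset.sum_congr rfl hvE, Finset.sum_congr rfl hvO, Finset.sum_congr rfl hvP, Finset.sum_congr rfl hvM, Finset.sum_const, Finset.sum_const, Finset.sum_const,
    Finset.sum_const, hcE', hcO', hcP', hcM']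
  abel

end Literature.NumberTheory.Rogawski1990
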